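import Summits.Schanuel.Schanuel.Theorems.RootDecomp1ValueCells

/-!
# RootDecomp1ValueCellsMembers — part 2/2 of the port of lens-1 gen 14 «VALUE CELLS» (ValueCells.lean 695ffd0d…): §7 CERTIFIED MEMBERS beyond the
round-6 calibration — the lines w·(1, ∛2, ∛4), ANY w ≠ 0 (w = e, w = π, …): E-stable ℚ-free cubic lines on which the summit's residue is the single
cell (1,2,2) of Cᵉ 30352 (OPEN). `--supports stmt-Schanuel-30352`. Split off for the 400-line lint; namespace and texts verbatim.
Sorry-free; standard axioms. Nothing here proves Schanuel; rung 0.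
-/

set_option linter.dupNamespace false

noncomputable section

namespace Summit.Schanuel.Schanuel.Theorems.RootDecomp1ValueCells

open Complex IntermediateField Module
open Literature.NumberTheory.Transcendental (exists_nsmul_mem_span_int)
open Literature.Barriers.Schanuel (gridExp gridField₁ smallTrdeg_thm_2_9_pos)
open Summit.Schanuel.Schanuel.Theorems.RootDecomp1EAnchor (isAlgebraic_of_mem_adjoin
  trdeg_adjoin_le_of_isAlgebraic span_range_le exists_nat_lt_of_lt_natCast)
open Summit.Schanuel.Schanuel.Theorems.RootDecomp1EEStableRung (one_le_trdeg_adjoin_of_transcendental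
  mul_mem_span_of_gens eLine_linearIndependent)
open Summit.Schanuel.Schanuel.Theorems.RootDecomp1EEStableStructure (eStable_prime_isLine)
open Summit.Schanuel.Schanuel.Theorems.RootDecomp1ArgumentCells (trdeg_args_le trdeg_vals_le
  trdeg_args_le_one_of_isAlgebraic_adjoin_singleton le_valDegree_of_exp_algebraic_mem)


/-! ## §7  CERTIFIED MEMBERS beyond the round-6 calibration: the lines `w·(1, ∛2, ∛4)`, ANY `w ≠ 0` (`w = e`, `w = π`, …)

Self-contained certificates (the tree's `RigidCore.DiazLadder.natDegree_minpoly_two_cpow_third` proves the same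
cubicity but its module is not built on the farm at writing time, so the five-line Kummer argument is repeated). -/

section Members

open Polynomial

/-- `∛2` (principal branch `2^{1/3}`). -/
def cbrtTwo : ℂ := (2 : ℂ) ^ (1 / 3 : ℂ)

/-- The cubic line through `w`: `(w, ∛2·w, ∛4·w)`. -/
def cbrtLine (w : ℂ) : Fin 3 → ℂ := ![w, cbrtTwo * w, cbrtTwo ^ 2 * w]

/-- `cbrtLine w 0 = w`. -/
theorem cbrtLine_zero (w : ℂ) : cbrtLine w 0 = w := rfl
/-- `cbrtLine w 1 = cbrtTwo * w`. -/
theorem cbrtLine_one (w : ℂ) : cbrtLine w 1 = cbrtTwo * w := rfl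
/-- `cbrtLine w 2 = cbrtTwo ^ 2 * w`. -/
theorem cbrtLine_two (w : ℂ) : cbrtLine w 2 = cbrtTwo ^ 2 * w := rfl

/-- `(∛2)³ = 2`. -/
theorem cbrtTwo_pow_three : cbrtTwo ^ 3 = 2 := by
  rw [cbrtTwo, ← Complex.cpow_nat_mul]
  norm_num

/-- `X³ − 2` is irreducible over `ℚ` (Kummer: `2` is not a rational cube — its `2`-adic valuation is `1`, not a
multiple of `3`). [folklore; same argument as `RigidCore.DiazLadder.irreducible_X_pow_three_sub_C_two`] -/
private theorem irreducible_X_pow_three_sub_C_two : Irreducible (X ^ 3 - C (2 : ℚ)) := by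
  refine X_pow_sub_C_irreducible_of_prime Nat.prime_three fun b h => ?_
  have h2 : padicValRat 2 ((2 : ℕ) : ℚ) = 1 := padicValRat.self one_lt_two
  rw [Nat.cast_ofNat, ← h, padicValRat.pow] at h2
  push_cast at h2
  omega

/-- `∛2` is a root of `X³ − 2`. -/
theorem aeval_cbrtTwo : aeval cbrtTwo (X ^ 3 - C (2 : ℚ)) = 0 := by
  simp [cbrtTwo_pow_three]

/-- The minimal polynomial of `∛2` over `ℚ` is `X³ − 2`. -/
theorem minpoly_cbrtTwo : minpoly ℚ cbrtTwo = X ^ 3 - C (2 : ℚ) :=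
  (minpoly.eq_of_irreducible_of_monic irreducible_X_pow_three_sub_C_two aeval_cbrtTwo
    (monic_X_pow_sub_C _ three_ne_zero)).symm

/-- `∛2` is cubic. -/
theorem natDegree_minpoly_cbrtTwo : (minpoly ℚ cbrtTwo).natDegree = 3 := by
  rw [minpoly_cbrtTwo, natDegree_X_pow_sub_C]

/-- `∛2` is algebraic. -/
theorem cbrtTwo_isAlgebraic : IsAlgebraic ℚ cbrtTwo :=
  ⟨X ^ 3 - C 2, X_pow_sub_C_ne_zero (by norm_num) 2, aeval_cbrtTwo⟩

/-- `∛2 ∉ ℚ`. -/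
theorem cbrtTwo_not_mem_range : cbrtTwo ∉ Set.range (algebraMap ℚ ℂ) := by
  have h2 : 2 ≤ (minpoly ℚ cbrtTwo).natDegree := by rw [natDegree_minpoly_cbrtTwo]; norm_num
  have h := (minpoly.two_le_natDegree_iff cbrtTwo_isAlgebraic.isIntegral).mp h2
  exact fun hmem => h (RingHom.mem_range.mpr hmem)

/-- `(1, ∛2, ∛4)` is ℚ-free. -/
theorem powers_cbrtTwo_linearIndependent : LinearIndependent ℚ ![(1 : ℂ), cbrtTwo, cbrtTwo ^ 2] := by
  have h := linearIndependent_pow (K := ℚ) cbrtTwo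
  rw [natDegree_minpoly_cbrtTwo] at h
  have he : (fun i : Fin 3 => cbrtTwo ^ (i : ℕ)) = ![(1 : ℂ), cbrtTwo, cbrtTwo ^ 2] := by
    funext i; fin_cases i <;> simp
  rw [← he]; exact h

/-- The line `w·(1, ∛2, ∛4)` is ℚ-free for `w ≠ 0`. -/
theorem cbrtLine_linearIndependent {w : ℂ} (hw : w ≠ 0) : LinearIndependent ℚ (cbrtLine w) := by
  have hinj : LinearMap.ker (LinearMap.mulRight ℚ w) = ⊥ :=
    LinearMap.ker_eq_bot.mpr fun a b hab => mul_left_injective₀ hw (by simpa [LinearMap.mulRight_apply] using hab)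
  have h := powers_cbrtTwo_linearIndependent.map' (LinearMap.mulRight ℚ w) hinj
  have he : ⇑(LinearMap.mulRight ℚ w) ∘ ![(1 : ℂ), cbrtTwo, cbrtTwo ^ 2] = cbrtLine w := by
    funext i; fin_cases i <;> simp [cbrtLine, LinearMap.mulRight_apply]
  rw [← he]; exact h

/-- The line `w·(1, ∛2, ∛4)` is E-STABLE (multiplier `∛2`: `∛2·z₀ = z₁`, `∛2·z₁ = z₂`, `∛2·z₂ = 2z₀`). -/
theorem cbrtLine_eStable (w : ℂ) : ∃ β : ℂ, IsAlgebraic ℚ β ∧ β ∉ Set.range (algebraMap ℚ ℂ) ∧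
    ∀ i, β * cbrtLine w i ∈ Submodule.span ℚ (Set.range (cbrtLine w)) := by
  refine ⟨cbrtTwo, cbrtTwo_isAlgebraic, cbrtTwo_not_mem_range, fun i => ?_⟩
  fin_cases i
  · show cbrtTwo * cbrtLine w 0 ∈ _
    rw [cbrtLine_zero, ← cbrtLine_one]
    exact Submodule.subset_span ⟨1, rfl⟩
  · show cbrtTwo * cbrtLine w 1 ∈ _
    have h : cbrtTwo * cbrtLine w 1 = cbrtLine w 2 := by rw [cbrtLine_one, cbrtLine_two]; ring
    rw [h]
    exact Submodule.subset_span ⟨2, rfl⟩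
  · show cbrtTwo * cbrtLine w 2 ∈ _
    have h : cbrtTwo * cbrtLine w 2 = (2 : ℚ) • cbrtLine w 0 := by
      rw [cbrtLine_two, cbrtLine_zero, Rat.smul_def]
      have h3 : cbrtTwo * (cbrtTwo ^ 2 * w) = cbrtTwo ^ 3 * w := by ring
      rw [h3, cbrtTwo_pow_three]
      push_cast
      ring
    rw [h]
    exact Submodule.smul_mem _ _ (Submodule.subset_span ⟨0, rfl⟩)

/-- **CERTIFIED MEMBERS `w·(1, ∛2, ∛4)`, ANY `w ≠ 0`** (`w = π` or a fixed point `ζ = e^ζ` have `e^w ∉ ℚ̄`, hence lie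
OUTSIDE the round-6 Gel'fond–Diaz cell `log α·(1, β, β²)`; `w = e` lies outside it iff `e^e ∉ ℚ̄`, unknown — the
certificate does not care): ℚ-free and E-stable; bidegree `trdeg ℚ(z) ≤ 1`, `2 ≤ trdeg ℚ(e^z)`; the D₃-instance
HOLDS; and Schanuel's conclusion at `z` ⟺ `z` is not a `(1,2,2)` atom, i.e. `trdeg ℚ(w, e^w, e^{∛2 w}, e^{∛4 w}) = 3`
— OPEN for every `w` with `e^w ∉ ℚ̄` or of unknown nature. -/
theorem cbrtLine_member (h29 : smallTrdeg_thm_2_9_pos) {w : ℂ} (hw : w ≠ 0) :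
    LinearIndependent ℚ (cbrtLine w) ∧
    Algebra.trdeg ℚ ↥(adjoin ℚ (Set.range (cbrtLine w))) ≤ 1 ∧
    (2 : Cardinal) ≤ Algebra.trdeg ℚ ↥(adjoin ℚ (Set.range (cexp ∘ cbrtLine w))) ∧
    (Algebra.trdeg ℚ ↥(adjoin ℚ (Set.range (cbrtLine w))) +
        Algebra.trdeg ℚ ↥(adjoin ℚ (Set.range (cexp ∘ cbrtLine w))) ≤
        Algebra.trdeg ℚ ↥(adjoin ℚ (Set.range (cbrtLine w) ∪ Set.range (cexp ∘ cbrtLine w))) →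
      ((3 : ℕ) : Cardinal) ≤
        Algebra.trdeg ℚ ↥(adjoin ℚ (Set.range (cbrtLine w) ∪ Set.range (cexp ∘ cbrtLine w)))) ∧
    (((3 : ℕ) : Cardinal) ≤
        Algebra.trdeg ℚ ↥(adjoin ℚ (Set.range (cbrtLine w) ∪ Set.range (cexp ∘ cbrtLine w))) ↔
      ¬ (Algebra.trdeg ℚ ↥(adjoin ℚ (Set.range (cbrtLine w))) = 1 ∧
          Algebra.trdeg ℚ ↥(adjoin ℚ (Set.range (cexp ∘ cbrtLine w))) = 2 ∧
          Algebra.trdeg ℚ ↥(adjoin ℚ (Set.range (cbrtLine w) ∪ Set.range (cexp ∘ cbrtLine w))) = 2)) :=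
  ⟨cbrtLine_linearIndependent hw,
    argDegree_le_one_of_eStable_three _ (cbrtLine_linearIndependent hw) (cbrtLine_eStable w),
    two_le_valDegree_of_eStable_three h29 _ (cbrtLine_linearIndependent hw) (cbrtLine_eStable w),
    disjointSchanuel_eStable_three h29 _ (cbrtLine_linearIndependent hw) (cbrtLine_eStable w),
    schanuel_iff_not_cell_one_two_of_eStable_three h29 _ (cbrtLine_linearIndependent hw) (cbrtLine_eStable w)⟩

/-- **MEMBER `e·(1, ∛2, ∛4)`** (base `w = e`, `e^w = e^e` of unknown nature): D₃ HOLDS there; Schanuel there reads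
`trdeg ℚ(e, e^e, e^{e∛2}, e^{e∛4}) = 3` — OPEN. -/
theorem member_e_cbrtLine (h29 : smallTrdeg_thm_2_9_pos) :
    LinearIndependent ℚ (cbrtLine (cexp 1)) ∧
    Algebra.trdeg ℚ ↥(adjoin ℚ (Set.range (cbrtLine (cexp 1)))) ≤ 1 ∧
    (2 : Cardinal) ≤ Algebra.trdeg ℚ ↥(adjoin ℚ (Set.range (cexp ∘ cbrtLine (cexp 1)))) ∧
    (Algebra.trdeg ℚ ↥(adjoin ℚ (Set.range (cbrtLine (cexp 1)))) +
        Algebra.trdeg ℚ ↥(adjoin ℚ (Set.range (cexp ∘ cbrtLine (cexp 1)))) ≤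
        Algebra.trdeg ℚ ↥(adjoin ℚ (Set.range (cbrtLine (cexp 1)) ∪ Set.range (cexp ∘ cbrtLine (cexp 1)))) →
      ((3 : ℕ) : Cardinal) ≤
        Algebra.trdeg ℚ ↥(adjoin ℚ (Set.range (cbrtLine (cexp 1)) ∪ Set.range (cexp ∘ cbrtLine (cexp 1))))) ∧
    (((3 : ℕ) : Cardinal) ≤
        Algebra.trdeg ℚ ↥(adjoin ℚ (Set.range (cbrtLine (cexp 1)) ∪ Set.range (cexp ∘ cbrtLine (cexp 1)))) ↔
      ¬ (Algebra.trdeg ℚ ↥(adjoin ℚ (Set.range (cbrtLine (cexp 1)))) = 1 ∧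
          Algebra.trdeg ℚ ↥(adjoin ℚ (Set.range (cexp ∘ cbrtLine (cexp 1)))) = 2 ∧
          Algebra.trdeg ℚ ↥(adjoin ℚ (Set.range (cbrtLine (cexp 1)) ∪
            Set.range (cexp ∘ cbrtLine (cexp 1)))) = 2)) :=
  cbrtLine_member h29 (Complex.exp_ne_zero 1)

/-- **MEMBER `π·(1, ∛2, ∛4)`** (base `w = π`, real; `e^π` transcendental by Gel'fond but `π ∉ 𝕃`): D₃ HOLDS there;
Schanuel there reads `trdeg ℚ(π, e^π, e^{π∛2}, e^{π∛4}) = 3` — OPEN (Nesterenko gives `2`). -/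
theorem member_pi_cbrtLine (h29 : smallTrdeg_thm_2_9_pos) :
    LinearIndependent ℚ (cbrtLine (Real.pi : ℂ)) ∧
    Algebra.trdeg ℚ ↥(adjoin ℚ (Set.range (cbrtLine (Real.pi : ℂ)))) ≤ 1 ∧
    (2 : Cardinal) ≤ Algebra.trdeg ℚ ↥(adjoin ℚ (Set.range (cexp ∘ cbrtLine (Real.pi : ℂ)))) ∧
    (Algebra.trdeg ℚ ↥(adjoin ℚ (Set.range (cbrtLine (Real.pi : ℂ)))) +
        Algebra.trdeg ℚ ↥(adjoin ℚ (Set.range (cexp ∘ cbrtLine (Real.pi : ℂ)))) ≤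
        Algebra.trdeg ℚ ↥(adjoin ℚ (Set.range (cbrtLine (Real.pi : ℂ)) ∪
          Set.range (cexp ∘ cbrtLine (Real.pi : ℂ)))) →
      ((3 : ℕ) : Cardinal) ≤
        Algebra.trdeg ℚ ↥(adjoin ℚ (Set.range (cbrtLine (Real.pi : ℂ)) ∪
          Set.range (cexp ∘ cbrtLine (Real.pi : ℂ))))) ∧
    (((3 : ℕ) : Cardinal) ≤
        Algebra.trdeg ℚ ↥(adjoin ℚ (Set.range (cbrtLine (Real.pi : ℂ)) ∪
          Set.range (cexp ∘ cbrtLine (Real.pi : ℂ)))) ↔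
      ¬ (Algebra.trdeg ℚ ↥(adjoin ℚ (Set.range (cbrtLine (Real.pi : ℂ)))) = 1 ∧
          Algebra.trdeg ℚ ↥(adjoin ℚ (Set.range (cexp ∘ cbrtLine (Real.pi : ℂ)))) = 2 ∧
          Algebra.trdeg ℚ ↥(adjoin ℚ (Set.range (cbrtLine (Real.pi : ℂ)) ∪
            Set.range (cexp ∘ cbrtLine (Real.pi : ℂ)))) = 2)) :=
  cbrtLine_member h29 (Complex.ofReal_ne_zero.mpr Real.pi_ne_zero)

end Members

end Summit.Schanuel.Schanuel.Theorems.RootDecomp1ValueCells
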